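/-
COR-CM (cell pub-hodgecm2, stage 2 of the Hodge ladder) — count-neutral KERNEL COMBINATORICS «the dihedral law», rows: `μ = 2, 22, 2174` for the
dihedral data of level `n = 2, 4, 8` (`D₄`, `D₈`, `D₁₆`) (seat prover-pub-hodgecm2-b23-g48-0, binder prover b23, gen 48; claim «DIHEDRAL LAW»,
HOME/INBOX.md l.22267).  Theorems only, on part IV (`Census/DihedralLaw.lean`) and the block count (`Census/DihedralBlockCount.lean`) BY NAME; no
`decide`, no certificate, no named fact, no `sorry`; `Interfaces.lean` (C1), every E term, B01, `Transposition/*`, `PortJoin/*`, `D2Bridge/*` untouched.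
HONEST FRAMING: `HC_CM` is NOT proved, here or anywhere in the tree; nothing here is a period, a count of record or a headline.
T5: n/a-class (hypothesis binders = the fields of `Dihedral.Datum`; checker: self).
-/
import Summits.HodgeConjecture.CorCM.Census.DihedralLaw
import Summits.HodgeConjecture.CorCM.Census.DihedralBlockCount

/-!
# The dihedral law, rows: `μ(D₄) = 2`, `μ(D₈) = 22`, `μ(D₁₆) = 2174`

The dihedral law `μ = β − 2` (`Dihedral.isLeast_card_gfaces_generate`) with the block counts `β = 4, 24, 2176` of
`Census/DihedralBlockCount.lean` for the dihedral data of level `n = 2, 4, 8` (groups `D(ℤ/4) = D₄` of order `8`, `D(ℤ/8) = D₈` of order `16`,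
`D(ℤ/16) = D₁₆` of order `32`, complex conjugation the central rotation): the least number of rank-four face relations whose base changes generate
the integer Hodge lattice modulo pairs is EXACTLY **`2`**, **`22`**, **`2174`** (`isLeast_card_gfaces_generate_two/_twentyTwo/_2174`).  The row
`D₄ = 2` is seat b30ʼs certificate row and lit-andre-3ʼs atlas row re-proved without a table; `D₈ = 22` and `D₁₆ = 2174` were gen 46ʼs numerics
(`HOME/pub-hodgecm2-b23/SPLIT-INDEX-TWO.md`) and are now theorems.  Nothing here is a period.

## References
* [Pohlmann1968] H. Pohlmann, Algebraic cycles on abelian varieties of complex multiplication type, Ann. of Math. 88 (1968), Thm 1.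
* [Milne1999] J. S. Milne, Lefschetz motives and the Tate conjecture, Compositio Math. 117 (1999), Prop. 2.1, p. 54.
-/

namespace Summit.HodgeConjecture.CorCM.Census.Dihedral

open Finset
open Summit.HodgeConjecture.CorCM.Prior.AllgGroup.RfwfAllgGroup
open Summit.HodgeConjecture.CorCM.Census.BlockParity
open Summit.HodgeConjecture.CorCM.Census.Coinvariant

noncomputable section

variable {G : Type*} [Group G] [Fintype G] [DecidableEq G] {c : G} (hc2 : c * c = 1) (hc1 : c ≠ 1)

include hc1 in
/-- **Row `D₄` (dihedral datum of level `2`, order `8`, `c = r²`): EXACTLY `2` generating face orbits.** [folklore] -/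
theorem isLeast_card_gfaces_generate_two (D : Datum G c 2) :
    IsLeast {m : ℕ | ∃ S : Finset (CMF G c →₀ ℤ), ↑S ⊆ gfaceSet G c hc2 ∧ S.card = m ∧
      hodgeSpan c hc2 ≤ Submodule.span ℤ (pairSet c) ⊔ Submodule.span ℤ (translates c S)} 2 := by
  have h := isLeast_card_gfaces_generate D hc2 hc1
  rwa [card_block_eq_four D hc2 hc1] at h

include hc1 in
/-- **Row `D₈` (dihedral datum of level `4`, order `16`, `c = r⁴`): EXACTLY `22` generating face orbits.** [folklore] -/
theorem isLeast_card_gfaces_generate_twentyTwo (D : Datum G c 4) :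
    IsLeast {m : ℕ | ∃ S : Finset (CMF G c →₀ ℤ), ↑S ⊆ gfaceSet G c hc2 ∧ S.card = m ∧
      hodgeSpan c hc2 ≤ Submodule.span ℤ (pairSet c) ⊔ Submodule.span ℤ (translates c S)} 22 := by
  have h := isLeast_card_gfaces_generate D hc2 hc1
  rwa [card_block_eq_twentyFour D hc2 hc1] at h

include hc1 in
/-- **Row `D₁₆` (dihedral datum of level `8`, order `32`, `c = r⁸`): EXACTLY `2174` generating face orbits.** [folklore] -/
theorem isLeast_card_gfaces_generate_2174 (D : Datum G c 8) :
    IsLeast {m : ℕ | ∃ S : Finset (CMF G c →₀ ℤ), ↑S ⊆ gfaceSet G c hc2 ∧ S.card = m ∧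
      hodgeSpan c hc2 ≤ Submodule.span ℤ (pairSet c) ⊔ Submodule.span ℤ (translates c S)} 2174 := by
  have h := isLeast_card_gfaces_generate D hc2 hc1
  rwa [card_block_eq_2176 D hc2 hc1] at h

include hc1 in
/-- **`φ₂ = 22` for a dihedral datum of level `4`** (`β = φ₂ + 2`). [folklore] -/
theorem fibreTwo_eq_twentyTwo (D : Datum G c 4) : fibreTwo c hc2 = 22 := by
  have h := card_block_eq_fibreTwo_add_two D hc2 hc1
  rw [card_block_eq_twentyFour D hc2 hc1] at h
  omega

include hc1 in
/-- **`φ₂ = 2174` for a dihedral datum of level `8`.** [folklore] -/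
theorem fibreTwo_eq_2174 (D : Datum G c 8) : fibreTwo c hc2 = 2174 := by
  have h := card_block_eq_fibreTwo_add_two D hc2 hc1
  rw [card_block_eq_2176 D hc2 hc1] at h
  omega

end

end Summit.HodgeConjecture.CorCM.Census.Dihedral
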